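import Mathlib
import Summits.AtomisticToContinuum.HydrodynamicLimit.Theorems.ImplosionDichotomyDenseExcursionCavityUniformDeepFrozen
import Literature.Analysis.ODE.BarrierTouchingComplex

/-!
# The deep zone of the energy regime, III: sup-norm closure at the centre
# (crux `DenseExcursion`, line `sonic-cavity-renewal`, bricks for stub `stub_cavityResolventCk`, theorem T7(iii))

Helper file (`--supports stmt-AtomisticToContinuum-12586`, line lead a2, stub-worker E3 for `stub_cavityResolventCk`,
energy regime `Re Λ → +∞`).

**Mathematics.** On the deep zone `x ≤ x_d`, `8‖Λ‖e^{x_d} = 1`, let `U = sup |ŵ|`, `V_s = sup |V|` (`V = e^{2x}Sŝ`; both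
finite for a pair with finite weighted sup). Two estimates close:
* `V` IS FROZEN: `|V(x) − V(x_d)| ≤ (3‖Λ‖V_s + ‖Λ‖U/2 + 3N)·e^{2x_d}/2` (`deep_V_frozen`, previous file), and
  `e^{2x_d} = 1/(64‖Λ‖²)`;
* `u` IS SLAVED TO ITS FORCING: `U ≤ (7/2)‖Λ‖V_s + (43/20)N` (`deep_u_slaved`), by the complex touching lemma
  (`Literature.Analysis.ODE.barrier_touching_complex`) for the attractive `u`-row `D u′ = μ_u u − F_u`
  (`Re μ_u ≥ (5/2)S²`, `deep_u_row_bounds`) with the barrier `1 + εe^{−x/2}` on `(−∞, x_d]` (`deep_u_touch`) — the weighted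
  gauge tends to `0` at `−∞` BECAUSE `ŵ` IS BOUNDED (this is where centre-regularity excludes the irregular branch
  `e^{−3x}`), the right endpoint `x_d` is an outflow point of the row, and `ε → 0`.
With the junction datum `|ŵ ± 3ŝ|(x_d) ≤ M₀` (so `‖Λ‖|V(x_d)| ≤ M₀/24`) the linear closure (`deep_closure_arith`) gives
`|ŵ| ≤ M₀ + 3N` and `eˣ|ŝ| ≤ (M₀ + N)/‖Λ‖` on the deep zone (`cavity_deep_bound`), uniformly in `Im Λ`.
Sources: folklore (Protter–Weinberger 1984 Ch. 1). NOT here: the assembly of the three zones (next file of worker E3).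
-/

noncomputable section

open Filter Set
open scoped Topology ContDiff

namespace Summit.AtomisticToContinuum.HydrodynamicLimit.Theorems.SonicCavityRenewal

open Summit.AtomisticToContinuum.HydrodynamicLimit.Theorems.R2OneModeTwoConditions
open Literature.Analysis.ODE

/-! ## Real arithmetic -/

/-- Arithmetic of the touching point of the `u`-row: from `θ(Re μ·Ū + Dε′/2) ≤ ‖F‖`, `Re μ ≥ (5/2)S²`, `−S² ≤ D`,
`Ū = 1 + ε′`, `ε′ > 0`, `‖F‖ ≤ S²(7LV_s + (43/10)N)`: `θŪ ≤ (7/2)LV_s + (43/20)N`. [folklore] -/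
theorem deep_touch_arith (θ Ubv ε' S2 D μre Fn L Vs N : ℝ) (hθ : 0 ≤ θ) (hUb : Ubv = 1 + ε') (hε' : 0 < ε')
    (hD2 : -S2 ≤ D) (hS2 : 0 < S2) (hμ : 5 / 2 * S2 ≤ μre) (hkey : θ * (μre * Ubv - D * (-(ε' / 2))) ≤ Fn)
    (hF : Fn ≤ S2 * (7 * L * Vs + 43 / 10 * N)) : θ * Ubv ≤ 7 / 2 * L * Vs + 43 / 20 * N := by
  have hUbpos : 0 < Ubv := by rw [hUb]; linarith
  have h1 : 2 * S2 * Ubv ≤ μre * Ubv - D * (-(ε' / 2)) := by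
    have : 5 / 2 * S2 * Ubv ≤ μre * Ubv := mul_le_mul_of_nonneg_right hμ hUbpos.le
    nlinarith
  have h2 : θ * (2 * S2 * Ubv) ≤ S2 * (7 * L * Vs + 43 / 10 * N) :=
    (mul_le_mul_of_nonneg_left h1 hθ).trans (hkey.trans hF)
  have h3 : S2 * (2 * (θ * Ubv)) ≤ S2 * (7 * L * Vs + 43 / 10 * N) := by
    calc S2 * (2 * (θ * Ubv)) = θ * (2 * S2 * Ubv) := by ring
      _ ≤ _ := h2
  have h4 := le_of_mul_le_mul_left h3 hS2
  linarith

/-- The linear closure of the deep zone: `T = ‖Λ‖V_s ≤ M₀/24 + (3/128)V_s + U/256 + N/2048`, `48V_s ≤ T`,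
`U ≤ (7/2)T + (43/20)N` imply `U ≤ M₀ + 3N` and `10T ≤ 7(M₀ + N)`. [folklore] -/
theorem deep_closure_arith (T Vs U M₀ N : ℝ) (hN : 0 ≤ N) (hM : 0 ≤ M₀) (hVsT : 48 * Vs ≤ T)
    (hT : T ≤ M₀ / 24 + 3 / 128 * Vs + U / 256 + N / 2048) (hU : U ≤ 7 / 2 * T + 43 / 20 * N) :
    U ≤ M₀ + 3 * N ∧ 10 * T ≤ 7 * (M₀ + N) := by
  constructor <;> linarith

/-! ## `u` is slaved to its forcing -/

/-- THE TOUCHING POINT OF THE `u`-ROW: if the gauge `‖ŵ‖/(1 + εe^{−y/2})` (`ε > 0`) is maximal on `[x_s − 1, x_d]` at a deep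
point `x_s ≤ x_d`, then `‖ŵ(x_s)‖ ≤ (7/2)‖Λ‖V_s + (43/20)N` (complex touching lemma for `D u′ = μ_u u − F_u` with
`Re μ_u ≥ (5/2)S²`, right endpoint outflow since `D < 0`). [folklore] -/
theorem deep_u_touch {r : ℝ} {W S : ℝ → ℝ} (hP : IsMonatomicProfile r W S) (hT : CavityTube r W S) {Λ : ℂ}
    {f g ŵ ŝ : ℝ → ℂ} {N xd Vs ε xs : ℝ} (hL : 48 ≤ ‖Λ‖) (hŵ : Differentiable ℝ ŵ)
    (hsol : ∀ x, x ≤ 1 → Λ * ŵ x - linW r W S ŵ ŝ x = f x ∧ Λ * ŝ x - linS r W S ŵ ŝ x = g x)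
    (hsrc : ∀ x, x ≤ 1 → ‖f x‖ + Real.exp x * ‖g x‖ ≤ N) (hxd : 8 * ‖Λ‖ * Real.exp xd = 1)
    (hVs : ∀ y, y ≤ xd → ‖((Real.exp (2 * y) * S y : ℝ) : ℂ) * ŝ y‖ ≤ Vs) (hε : 0 < ε) (hxs : xs ≤ xd)
    (hmax : IsMaxOn (fun y => ‖ŵ y‖ / (1 + ε * Real.exp (-y / 2))) (Icc (xs - 1) xd) xs) :
    ‖ŵ xs‖ ≤ 7 / 2 * ‖Λ‖ * Vs + 43 / 20 * N := by
  obtain ⟨hr, hr3, hW, hS, hSpos, -⟩ := id hP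
  have hr2 : r < 2 := by
    have h13 : (1 : ℝ) < Real.sqrt 3 := (Real.lt_sqrt (by norm_num)).mpr (by norm_num)
    linarith
  have hN : 0 ≤ N := by
    have h := hsrc 0 (by norm_num)
    have : 0 ≤ ‖f 0‖ + Real.exp 0 * ‖g 0‖ := by positivity
    linarith
  obtain ⟨hxs1, h268, hS7, hSe, hσ7, -, hinv, hLS, hWs, hW's, hσ⟩ := deep_facts hT hL hxd hxs
  -- the barrier
  set Ub : ℝ → ℝ := fun y => 1 + ε * Real.exp (-y / 2) with hUbdef
  have hUbpos : ∀ y, 0 < Ub y := fun y => by simp only [hUbdef]; positivity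
  have hUbd : HasDerivAt Ub (-(ε * Real.exp (-xs / 2) / 2)) xs := by
    have hl : HasDerivAt (fun y : ℝ => -y / 2) (-1 / 2) xs := by
      simpa using ((hasDerivAt_id xs).neg).div_const 2
    have h1 := (hl.exp.const_mul ε).const_add 1
    refine h1.congr_deriv ?_
    ring
  -- sources at `xs`
  have hfg := hsrc xs hxs1
  have hf0 : 0 ≤ ‖f xs‖ := norm_nonneg _
  have hg0 : 0 ≤ ‖g xs‖ := norm_nonneg _
  have hexs : 0 < Real.exp xs := Real.exp_pos xs
  have hFn : ‖f xs‖ ≤ N := by nlinarith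
  have hGn : ‖g xs‖ ≤ N * Real.exp (-xs) := by
    have h1 : Real.exp xs * ‖g xs‖ ≤ N := by linarith
    have h2 := mul_le_mul_of_nonneg_left h1 (Real.exp_pos (-xs)).le
    rwa [← mul_assoc, mul_comm (Real.exp (-xs)) (Real.exp xs), hinv, one_mul, mul_comm] at h2
  -- the row, its bounds, the touching lemma
  have hrow := deep_u_row (hsol xs hxs1)
  obtain ⟨hD, hD2, hμ, hF⟩ := deep_u_row_bounds Λ (ŝ xs) (f xs) (g xs) r (W xs) (deriv W xs) (S xs) (deriv S xs)
    (Real.exp xs) (Real.exp (-xs)) N hWs hW's hσ hr hr2 h268 hS7 hσ7 hLS hL hN hFn hGn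
  have key := barrier_touching_complex (y := ŵ) (yb := Ub) (yb' := -(ε * Real.exp (-xs / 2) / 2))
    (x₁ := xs - 1) (x₂ := xd) ⟨by linarith, hxs⟩ (hŵ xs).hasDerivAt hUbd (fun y _ => hUbpos y) hmax hrow
    (fun h => by linarith) (fun _ => hD.le)
  -- `‖F‖ ≤ S²(7‖Λ‖V_s + 4.3N)`
  have hVxs : Real.exp xs ^ 2 * S xs * ‖ŝ xs‖ = ‖((Real.exp (2 * xs) * S xs : ℝ) : ℂ) * ŝ xs‖ := by
    rw [norm_V_eq hSpos ŝ xs]; ring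
  have hF' : 7 * ‖Λ‖ * S xs ^ 3 * Real.exp xs ^ 2 * ‖ŝ xs‖ + 43 / 10 * N * S xs ^ 2 ≤
      S xs ^ 2 * (7 * ‖Λ‖ * Vs + 43 / 10 * N) := by
    have e1 : 7 * ‖Λ‖ * S xs ^ 3 * Real.exp xs ^ 2 * ‖ŝ xs‖ =
        7 * ‖Λ‖ * S xs ^ 2 * (Real.exp xs ^ 2 * S xs * ‖ŝ xs‖) := by ring
    rw [e1, hVxs]
    have := mul_le_mul_of_nonneg_left (hVs xs hxs) (by positivity : (0 : ℝ) ≤ 7 * ‖Λ‖ * S xs ^ 2)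
    nlinarith
  have hθ0 : 0 ≤ ‖ŵ xs‖ / Ub xs := div_nonneg (norm_nonneg _) (hUbpos xs).le
  have hθUb := deep_touch_arith (‖ŵ xs‖ / Ub xs) (Ub xs) (ε * Real.exp (-xs / 2)) (S xs ^ 2)
    ((W xs - 1) ^ 2 - S xs ^ 2) _ _ ‖Λ‖ Vs N hθ0 rfl (by positivity) (by linarith) (by positivity) hμ key
    (hF.trans hF')
  rwa [div_mul_cancel₀ _ (hUbpos xs).ne'] at hθUb

/-- `u` IS SLAVED TO ITS FORCING ON THE DEEP ZONE: `‖ŵ(z)‖ ≤ (7/2)‖Λ‖V_s + (43/20)N` for `z ≤ x_d` (the gauge with barrier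
`1 + εe^{−y/2}` attains its maximum on `(−∞, x_d]` because `ŵ` is bounded; `deep_u_touch`; `ε → 0`). [folklore] -/
theorem deep_u_slaved {r : ℝ} {W S : ℝ → ℝ} (hP : IsMonatomicProfile r W S) (hT : CavityTube r W S) {Λ : ℂ}
    {f g ŵ ŝ : ℝ → ℂ} {N B xd Vs : ℝ} (hL : 48 ≤ ‖Λ‖) (hŵ : Differentiable ℝ ŵ)
    (hsol : ∀ x, x ≤ 1 → Λ * ŵ x - linW r W S ŵ ŝ x = f x ∧ Λ * ŝ x - linS r W S ŵ ŝ x = g x)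
    (hsrc : ∀ x, x ≤ 1 → ‖f x‖ + Real.exp x * ‖g x‖ ≤ N) (hB : ∀ x, x ≤ 1 → ‖ŵ x‖ + Real.exp x * ‖ŝ x‖ ≤ B)
    (hxd : 8 * ‖Λ‖ * Real.exp xd = 1) (hVs : ∀ y, y ≤ xd → ‖((Real.exp (2 * y) * S y : ℝ) : ℂ) * ŝ y‖ ≤ Vs)
    (hVs0 : 0 ≤ Vs) {z : ℝ} (hz : z ≤ xd) : ‖ŵ z‖ ≤ 7 / 2 * ‖Λ‖ * Vs + 43 / 20 * N := by
  have hN : 0 ≤ N := by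
    have h := hsrc 0 (by norm_num)
    have : 0 ≤ ‖f 0‖ + Real.exp 0 * ‖g 0‖ := by positivity
    linarith
  have hB0 : 0 ≤ B := by
    have h := hB 0 (by norm_num)
    have : 0 ≤ ‖ŵ 0‖ + Real.exp 0 * ‖ŝ 0‖ := by positivity
    linarith
  have hwB : ∀ y, y ≤ xd → ‖ŵ y‖ ≤ B := by
    intro y hy
    obtain ⟨hy1, -⟩ := deep_facts hT hL hxd hy
    have hb := hB y hy1
    have : 0 ≤ Real.exp y * ‖ŝ y‖ := by positivity
    linarith
  set R : ℝ := 7 / 2 * ‖Λ‖ * Vs + 43 / 20 * N with hRdef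
  have hR0 : 0 ≤ R := by positivity
  -- bound for every `ε > 0`
  have hεb : ∀ ε : ℝ, 0 < ε → ‖ŵ z‖ ≤ R * (1 + ε * Real.exp (-z / 2)) := by
    intro ε hε
    set Ub : ℝ → ℝ := fun y => 1 + ε * Real.exp (-y / 2) with hUbdef
    have hUb1 : ∀ y, 1 ≤ Ub y := fun y => by simp only [hUbdef]; nlinarith [Real.exp_pos (-y / 2)]
    have hUbpos : ∀ y, 0 < Ub y := fun y => lt_of_lt_of_le one_pos (hUb1 y)
    have hUbc : Continuous Ub := continuous_const.add (continuous_const.mul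
      (Real.continuous_exp.comp (continuous_id.neg.div_const 2)))
    have hgc : ContinuousOn (fun y => ‖ŵ y‖ / Ub y) (Iic xd) :=
      (hŵ.continuous.norm.div hUbc fun y => (hUbpos y).ne').continuousOn
    have hg0 : ∀ y ∈ Iic xd, 0 ≤ ‖ŵ y‖ / Ub y := fun y _ => div_nonneg (norm_nonneg _) (hUbpos y).le
    have hglim : Tendsto (fun y => ‖ŵ y‖ / Ub y) atBot (𝓝 0) := by
      have hb : ∀ᶠ y in atBot, ‖‖ŵ y‖ / Ub y‖ ≤ B / ε * Real.exp (y / 2) := by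
        filter_upwards [eventually_le_atBot xd] with y hy
        rw [Real.norm_eq_abs, abs_of_nonneg (div_nonneg (norm_nonneg _) (hUbpos y).le)]
        have hlow : ε * Real.exp (-y / 2) ≤ Ub y := by simp only [hUbdef]; linarith
        have hpos : 0 < ε * Real.exp (-y / 2) := by positivity
        calc ‖ŵ y‖ / Ub y ≤ B / (ε * Real.exp (-y / 2)) := div_le_div₀ hB0 (hwB y hy) hpos hlow
          _ = B / ε * Real.exp (y / 2) := by
            rw [show -y / 2 = -(y / 2) by ring, Real.exp_neg]
            field_simp
      refine squeeze_zero_norm' hb ?_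
      have h := (Real.tendsto_exp_atBot.comp (tendsto_id.atBot_div_const (by norm_num : (0 : ℝ) < 2))).const_mul
        (B / ε)
      simpa using h
    obtain ⟨xs, hxs, hmax⟩ := exists_isMaxOn_Iic_of_tendsto_zero hgc hg0 hglim
    have hxs' : xs ≤ xd := hxs
    have hmaxI : IsMaxOn (fun y => ‖ŵ y‖ / Ub y) (Icc (xs - 1) xd) xs := hmax.on_subset Icc_subset_Iic_self
    have htouch : ‖ŵ xs‖ ≤ R := deep_u_touch hP hT hL hŵ hsol hsrc hxd hVs hε hxs' hmaxI
    have hz1 : ‖ŵ z‖ / Ub z ≤ ‖ŵ xs‖ / Ub xs := hmax hz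
    have hz2 : ‖ŵ z‖ ≤ ‖ŵ xs‖ / Ub xs * Ub z := by rwa [div_le_iff₀ (hUbpos z)] at hz1
    have hz3 : ‖ŵ xs‖ / Ub xs ≤ ‖ŵ xs‖ := div_le_self (norm_nonneg _) (hUb1 xs)
    calc ‖ŵ z‖ ≤ ‖ŵ xs‖ / Ub xs * Ub z := hz2
      _ ≤ ‖ŵ xs‖ * Ub z := mul_le_mul_of_nonneg_right hz3 (hUbpos z).le
      _ ≤ R * Ub z := mul_le_mul_of_nonneg_right htouch (hUbpos z).le
      _ = R * (1 + ε * Real.exp (-z / 2)) := rfl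
  have hlim : Tendsto (fun ε : ℝ => R * (1 + ε * Real.exp (-z / 2))) (𝓝[>] 0) (𝓝 R) := by
    have h : Tendsto (fun ε : ℝ => R * (1 + ε * Real.exp (-z / 2))) (𝓝 0)
        (𝓝 (R * (1 + 0 * Real.exp (-z / 2)))) :=
      (continuous_const.mul (continuous_const.add (continuous_id.mul continuous_const))).tendsto 0
    rw [zero_mul, add_zero, mul_one] at h
    exact h.mono_left nhdsWithin_le_nhds
  exact ge_of_tendsto hlim (eventually_nhdsWithin_of_forall fun ε hε => hεb ε hε)

/-! ## The deep-zone bound -/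

/-- **Registered helper `cavity_deep_bound` (worker E3, theorem T7(iii) of `stub_cavityResolventCk`): THE DEEP ZONE OF THE
ENERGY REGIME.** For a monatomic tube profile, `‖Λ‖ ≥ 48` (any `Re Λ`), a differentiable pair with finite weighted sup on `x ≤ 1` solving
the resolvent equations with source `|f| + eˣ|g| ≤ N` on `x ≤ 1`, and the deep-zone edge `x_d` (`8‖Λ‖e^{x_d} = 1`) with datum
`|ŵ ± 3ŝ|(x_d) ≤ M₀`: on `x ≤ x_d` one has `|ŵ| ≤ M₀ + 3N` and `eˣ|ŝ| ≤ (M₀ + N)/‖Λ‖` (frozen `V = e^{2x}Sŝ` + attractive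
`u`-row slaved to its forcing; uniform in `Im Λ`). [folklore] -/
theorem cavity_deep_bound : ∀ (r : ℝ) (W S : ℝ → ℝ), IsMonatomicProfile r W S → CavityTube r W S → ∀ (Λ : ℂ) (f g ŵ ŝ : ℝ → ℂ) (N B M₀ xd : ℝ), 48 ≤ ‖Λ‖ → Differentiable ℝ ŵ → Differentiable ℝ ŝ → (∀ x, x ≤ 1 → Λ * ŵ x - linW r W S ŵ ŝ x = f x ∧ Λ * ŝ x - linS r W S ŵ ŝ x = g x) → (∀ x, x ≤ 1 → ‖f x‖ + Real.exp x * ‖g x‖ ≤ N) → (∀ x, x ≤ 1 → ‖ŵ x‖ + Real.exp x * ‖ŝ x‖ ≤ B) → 8 * ‖Λ‖ * Real.exp xd = 1 → ‖ŵ xd + 3 * ŝ xd‖ ≤ M₀ → ‖ŵ xd - 3 * ŝ xd‖ ≤ M₀ → ∀ x, x ≤ xd → ‖ŵ x‖ ≤ M₀ + 3 * N ∧ Real.exp x * ‖ŝ x‖ ≤ (M₀ + N) / ‖Λ‖ := by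
  intro r W S hP hT Λ f g ŵ ŝ N B M₀ xd hL' hŵ hŝ hsol hsrc hB hxd hpd hmd x hx
  have hSpos : ∀ x, 0 < S x := hP.2.2.2.2.1
  set L : ℝ := ‖Λ‖ with hLdef
  have hL : 48 ≤ L := hL'
  have hLpos : 0 < L := by linarith
  have hexd : Real.exp xd = 1 / (8 * L) := by field_simp; linarith
  have hN : 0 ≤ N := by
    have h := hsrc 0 (by norm_num)
    have : 0 ≤ ‖f 0‖ + Real.exp 0 * ‖g 0‖ := by positivity
    linarith
  have hM₀ : 0 ≤ M₀ := (norm_nonneg _).trans hpd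
  -- the two suprema
  set V : ℝ → ℂ := fun y => ((Real.exp (2 * y) * S y : ℝ) : ℂ) * ŝ y with hVdef
  have hVB : ∀ y, y ≤ xd → ‖V y‖ ≤ B := by
    intro y hy
    obtain ⟨hy1, -, -, -, -, h1, -⟩ := deep_facts hT hL' hxd hy
    have hb := hB y hy1
    have hs : Real.exp y * ‖ŝ y‖ ≤ B := by linarith [norm_nonneg (ŵ y)]
    simp only [hVdef]
    rw [norm_V_eq hSpos ŝ y]
    calc Real.exp y * (Real.exp y * S y) * ‖ŝ y‖ ≤ Real.exp y * 1 * ‖ŝ y‖ := by gcongr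
      _ = Real.exp y * ‖ŝ y‖ := by ring
      _ ≤ B := hs
  have hwB : ∀ y, y ≤ xd → ‖ŵ y‖ ≤ B := by
    intro y hy
    obtain ⟨hy1, -⟩ := deep_facts hT hL' hxd hy
    have hb := hB y hy1
    have : 0 ≤ Real.exp y * ‖ŝ y‖ := by positivity
    linarith
  have hbddV : BddAbove ((fun y => ‖V y‖) '' Iic xd) := ⟨B, by rintro _ ⟨y, hy, rfl⟩; exact hVB y hy⟩
  have hbddU : BddAbove ((fun y => ‖ŵ y‖) '' Iic xd) := ⟨B, by rintro _ ⟨y, hy, rfl⟩; exact hwB y hy⟩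
  set Vs : ℝ := sSup ((fun y => ‖V y‖) '' Iic xd) with hVsdef
  set U : ℝ := sSup ((fun y => ‖ŵ y‖) '' Iic xd) with hUdef
  have hVle : ∀ y, y ≤ xd → ‖V y‖ ≤ Vs := fun y hy => le_csSup hbddV ⟨y, hy, rfl⟩
  have hUle : ∀ y, y ≤ xd → ‖ŵ y‖ ≤ U := fun y hy => le_csSup hbddU ⟨y, hy, rfl⟩
  have hne : ((fun y => ‖V y‖) '' Iic xd).Nonempty := ⟨_, xd, self_mem_Iic, rfl⟩
  have hneU : ((fun y => ‖ŵ y‖) '' Iic xd).Nonempty := ⟨_, xd, self_mem_Iic, rfl⟩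
  have hVs0 : 0 ≤ Vs := (norm_nonneg _).trans (hVle xd le_rfl)
  have hU0 : 0 ≤ U := (norm_nonneg _).trans (hUle xd le_rfl)
  -- `V` frozen ⇒ `Vs ≤ ‖V xd‖ + MV e^{2xd}/2`
  have hVs_bound : Vs ≤ ‖V xd‖ + (3 * L * Vs + L / 2 * U + 3 * N) * Real.exp (2 * xd) / 2 := by
    refine csSup_le hne ?_
    rintro _ ⟨y, hy, rfl⟩
    have hfz := deep_V_frozen r W S hP hT Λ f g ŵ ŝ N xd Vs U hL' hŝ hsol hsrc hxd hVle hUle hVs0 hU0 y hy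
    calc ‖V y‖ = ‖V xd + (V y - V xd)‖ := by rw [add_sub_cancel]
      _ ≤ ‖V xd‖ + ‖V y - V xd‖ := norm_add_le _ _
      _ ≤ _ := by simp only [hVdef] at hfz ⊢; linarith
  -- `u` slaved ⇒ `U ≤ (7/2) L Vs + (43/20) N`
  have hU_bound : U ≤ 7 / 2 * L * Vs + 43 / 20 * N := by
    refine csSup_le hneU ?_
    rintro _ ⟨y, hy, rfl⟩
    exact deep_u_slaved hP hT hL' hŵ hsol hsrc hB hxd hVle hVs0 hy
  -- the datum at `xd`
  obtain ⟨hxd1, -, -, -, hσ7d, h1d, -⟩ := deep_facts hT hL' hxd (le_refl xd)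
  have hsd : ‖ŝ xd‖ ≤ M₀ / 3 := by
    have h6 : (6 : ℂ) * ŝ xd = (ŵ xd + 3 * ŝ xd) - (ŵ xd - 3 * ŝ xd) := by ring
    have hn : 6 * ‖ŝ xd‖ ≤ M₀ + M₀ := by
      have := norm_sub_le (ŵ xd + 3 * ŝ xd) (ŵ xd - 3 * ŝ xd)
      rw [← h6, norm_mul] at this
      norm_num at this
      linarith
    linarith
  have hVxd : L * ‖V xd‖ ≤ M₀ / 24 := by
    simp only [hVdef]
    rw [norm_V_eq hSpos ŝ xd]
    have t : Real.exp xd * S xd * ‖ŝ xd‖ ≤ 1 * (M₀ / 3) := mul_le_mul h1d hsd (norm_nonneg _) zero_le_one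
    have hLe : L * Real.exp xd = 1 / 8 := by rw [hexd]; field_simp
    calc L * (Real.exp xd * (Real.exp xd * S xd) * ‖ŝ xd‖) = L * Real.exp xd * (Real.exp xd * S xd * ‖ŝ xd‖) := by
          ring
      _ = 1 / 8 * (Real.exp xd * S xd * ‖ŝ xd‖) := by rw [hLe]
      _ ≤ 1 / 8 * (1 * (M₀ / 3)) := by gcongr
      _ = M₀ / 24 := by ring
  have he2d : Real.exp (2 * xd) = 1 / (64 * L ^ 2) := by
    rw [show (2 : ℝ) * xd = xd + xd by ring, Real.exp_add, hexd]; field_simp; ring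
  have hT' : L * Vs ≤ M₀ / 24 + 3 / 128 * Vs + U / 256 + N / 2048 := by
    have h1 := mul_le_mul_of_nonneg_left hVs_bound hLpos.le
    rw [mul_add, he2d] at h1
    have h2 : L * ((3 * L * Vs + L / 2 * U + 3 * N) * (1 / (64 * L ^ 2)) / 2) =
        3 / 128 * Vs + U / 256 + 3 * N / (128 * L) := by
      field_simp; ring
    rw [h2] at h1
    have h3 : 3 * N / (128 * L) ≤ N / 2048 := by
      rw [div_le_div_iff₀ (by positivity) (by norm_num)]; nlinarith
    linarith
  have hVsT : 48 * Vs ≤ L * Vs := mul_le_mul_of_nonneg_right hL hVs0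
  obtain ⟨hUfin, hTfin⟩ := deep_closure_arith (L * Vs) Vs U M₀ N hN hM₀ hVsT hT'
    (by linarith [hU_bound])
  -- conclusion at `x`
  refine ⟨(hUle x hx).trans hUfin, ?_⟩
  obtain ⟨hx1, -, -, -, hσ7x, -⟩ := deep_facts hT hL' hxd hx
  have hVx := hVle x hx
  simp only [hVdef] at hVx
  rw [norm_V_eq hSpos ŝ x] at hVx
  have h1 : 7 / 10 * (Real.exp x * ‖ŝ x‖) ≤ Vs := by
    calc 7 / 10 * (Real.exp x * ‖ŝ x‖) ≤ Real.exp x * S x * (Real.exp x * ‖ŝ x‖) :=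
          mul_le_mul_of_nonneg_right hσ7x (by positivity)
      _ = Real.exp x * (Real.exp x * S x) * ‖ŝ x‖ := by ring
      _ ≤ Vs := hVx
  rw [le_div_iff₀ hLpos]
  nlinarith

end Summit.AtomisticToContinuum.HydrodynamicLimit.Theorems.SonicCavityRenewal

end
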